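import Summits.HodgeConjecture.CorCM.CMSixfoldRank.Separating
import Summits.HodgeConjecture.CorCM.CMSixfoldRank.ThreeClasses
import HarnessLib

/-!
# A primitive CM type on twelve embeddings has rank at least `6`; rank `6` iff a balanced transversal exists

Abstract setting of `CMTypeRank.lean` (a group `G` acting on the finite set `E` of embeddings, a central
fixed-point-free involution `ρ` — complex conjugation —, a CM type `Φ ⊆ E`, `IsCMTypeWith ρ Φ`, the Kubota–Dodson
rank `typeRank G Φ`, primitivity as the separation property `isPrimitive_iff_forall_eq`).  Everything here is
PROVED; no definition, no named fact (D-0014/D-0026).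

For `|E| = 2n = 12` (CM fields of degree `12`, CM abelian SIXFOLDS) the printed bounds give, for a PRIMITIVE type,
`5 ≤ rank ≤ 7`: Kubota's `rank ≤ n + 1` (`typeRank_le`) and Ribet's `log₂`-bound `2|E| ≤ 2^{rank}` (Dodson 1987
Thm. 1.0 (iii), `two_mul_card_le_two_pow_typeRank`); Ribet's `p + 1` bound (Dodson Thm. 1.4, `p = 3`) gives only
`4`.  Dodson's table of sharp lower bounds `B(n)` (Cor. 1.5: "`n = 2p` with `p` a prime LARGER than `3` … `B(n) =
p + 1`") leaves `n = 6` open.  This file proves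

* `six_le_typeRank_of_card_eq_twelve` — **`B(6) ≥ 6`: a primitive CM type on `12` embeddings has
  rank `≥ 6`** (so rank `∈ {6, 7}`: degenerate by at most one);
* `typeRank_eq_six_iff_exists_transversal_of_card_eq_twelve` — for such a type, `rank = 6` iff a
  BALANCED TRANSVERSAL exists (`Ψ ⊆ E`, `x ∈ Ψ ↔ ρx ∉ Ψ`, whose indicator satisfies Pohlmann's condition), by the
  tree's corank-one theorem `exists_transversal_isBalanced_of_typeRank_eq` and `symm_of_isBalanced_of_typeRank_eq`.
  By `BalancedTransversalBlock` such a `Ψ` is a block with two translates: for a CM field `K` of degree `12` this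
  is an imaginary quadratic subfield `k ⊆ K` over which `Φ` has multiplicities `(3,3)` (number-field dress in
  the companion file `SimpleCMSixfoldNondegenerate.lean` of this directory).

PROOF of the bound (elementary; not found in print — presearch in the module of the number-field dress; the
statement was first checked by brute force over all `944` signed-permutation models of degree `12`, `842` of them
primitive, `118` degenerate, all of rank `6`).  Suppose `rank = 5`.  Kubota's defect space `M` (balanced
`ρ`-anti-invariant weights, `exists_balanced_anti_subspace`) has dimension `≥ 2` and is `G`-stable.  Call `x, y ∈ E`
EQUIVALENT when every `μ ∈ M` takes the same value at `x` and `y`; classes have a common size `s` (transitivity),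
the class of `ρx` is `ρ`(class of `x`) and is disjoint from it (no `μ`-null point, by transitivity and `M ≠ 0`).
Every `μ ∈ M` sums to `0` over every translate `g⁻¹Φ` (balanced + anti-invariant).
* `s = 1` (the values of `M` separate `E` up to nothing): for each `g`, `Φ ∩ g⁻¹Φ` and `Φ ∖ g⁻¹Φ` are `M`-null; an
  `M`-null subset of `Φ` has neither `1` nor `2` elements, so `|Φ ∖ g⁻¹Φ| ∈ {0, 3, 6}`, and two `M`-null `3`-subsets
  of `Φ` with null complements are equal or complementary; hence every `u_g = 2·𝟙_{g⁻¹Φ} − 1` is `±u_1` or `±u_{g₁}`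
  for one fixed `g₁`: `rank ≤ 3`.
* the classes of `x₁` and `ρx₁` exhaust `E`: every `μ ∈ M` is `μ(x₁)` times a fixed sign function: `dim M ≤ 1`.
* otherwise a class outside has its own disjoint pair of classes, so `4s ≤ 12`, `s ∈ {2, 3}`;
  `s = 3`: `E` = four classes `F₁, ρF₁, F₂, ρF₂`; `Σ_Φ μ = (2a−3)μ(x₁) + (2b−3)μ(x₂) = 0` with odd coefficients, so
  again `dim M ≤ 1`;
  `s = 2`: three pairs of classes `{v_j, v_j'} ⊔ ρ{v_j, v_j'}`; `Σ_Φ μ = Σ_j c_j μ(v_j)` with `c_j = ±2` if `Φ` is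
  PURE at `j` (`v_j ∈ Φ ↔ v_j' ∈ Φ`) and `0` if MIXED, so the number of pure classes is `0` or `3` (one pure class
  gives a null point, two give equivalent representatives); a translate `g⁻¹Φ` is pure at `j` iff `Φ` is pure at the
  class of `g v_j`; primitivity separates `v₁ ≠ v₁'` by some translate, which is then mixed at `1`, so `Φ` is mixed
  somewhere, hence everywhere, hence every translate is mixed everywhere — and then the three anti-invariant
  weights `𝟙_{v_j} + 𝟙_{v_j'} − 𝟙_{ρv_j} − 𝟙_{ρv_j'}` are balanced and independent: `rank + 3 ≤ 7`.
All four endings contradict `rank = 5`, `dim M ≥ 2`.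

## References (held texts; statements re-read for this file)

* B. Dodson, *On the Mumford–Tate group of an abelian variety with complex multiplication*, J. Algebra 111 (1987)
  [Dodson1987] (`paper:doi-10-1016-0021-8693-87-90242-0`): p0003 Thm. 1.0 (i)–(v), Remark 1.1 ("`B(n) < n + 1`
  whenever `n` is composite"), Thm. 1.4 (Ribet); p0004 Cor. 1.5 ("Let `n = 2p` with `p` a prime larger than `3` …
  Then `B(n) = p + 1`").
* B. Dodson, *The structure of Galois groups of CM-fields*, Trans. AMS 283 (1984) [Dodson1984]
  (`paper:doi-10-2307-1999987`): §3.2.1 (degenerate types in composite dimension), §5.3 and p0026 Theorem (the 66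
  `ρ`-structures for `n = 6`), p0016 Remarks ("Note the exceptional case `n' = 6` …").
* T. Kubota, Trans. AMS 118 (1965) [Kubota1965], §4 (defect).  K. A. Ribet, Mém. SMF 2 (1980) [Ribet1980], §3 (3.5).
* B. B. Gordon, *A survey of the Hodge conjecture for abelian varieties* [Gordon1999HodgeAVSurvey], §9.2 (9.2.1), 9.4,
  Thm. 6.4 (Hazama).
-/

noncomputable section

open scoped BigOperators Pointwise Classical

namespace Summit.HodgeConjecture.CorCM.CMSixfoldRank

open Literature.NumberTheory.ComplexMultiplication
open Literature.NumberTheory.ComplexMultiplication.IsCMTypeWith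

variable {G : Type*} [Group G] {E : Type*} [MulAction G E]

variable {ρ : G} {Φ : Set E} (h : IsCMTypeWith ρ Φ)
include h


section NonSeparating

/-- **`rank = 5` is impossible on twelve embeddings** (primitive type, transitive action): Kubota's defect
space has dimension `≥ 2`; the four cases on the classes of points with equal values. [folklore] -/
theorem false_of_typeRank_eq_five [Fintype E] [MulAction.IsPretransitive G E]
    (M : Submodule ℚ (E → ℚ)) (hMa : ∀ μ ∈ M, ∀ x, μ (ρ • x) = -μ x) (hMb : ∀ μ ∈ M, IsBalanced G Φ μ)
    (hMG : ∀ μ ∈ M, ∀ g : G, (fun x => μ (g • x)) ∈ M) (hM2 : 2 ≤ Module.finrank ℚ M)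
    (hcard : Fintype.card E = 12) (hsep : ∀ x y : E, (∀ g : G, g • x ∈ Φ ↔ g • y ∈ Φ) → x = y)
    (hrank : typeRank G Φ = 5) : False := by
  haveI : Nonempty E := Fintype.card_pos_iff.1 (by omega)
  have hM : M ≠ ⊥ := by
    rintro rfl
    rw [finrank_bot] at hM2
    omega
  -- the value map `o : E → Dual M`
  let o : E → Module.Dual ℚ M := fun x => (LinearMap.proj x : (E → ℚ) →ₗ[ℚ] ℚ) ∘ₗ M.subtype
  have ho_apply : ∀ (x : E) (μ : M), o x μ = (μ : E → ℚ) x := fun _ _ => rfl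
  have ho : ∀ x y, o x = o y ↔ ∀ μ ∈ M, μ x = μ y := by
    intro x y
    constructor
    · intro hxy μ hμ
      have h1 := LinearMap.congr_fun hxy ⟨μ, hμ⟩
      simpa only [ho_apply] using h1
    · intro hxy
      apply LinearMap.ext
      rintro ⟨μ, hμ⟩
      simpa only [ho_apply] using hxy μ hμ
  have hoρ : ∀ x, o (ρ • x) = -o x := fun x => by
    apply LinearMap.ext
    rintro ⟨μ, hμ⟩
    simp only [ho_apply, LinearMap.neg_apply]
    exact hMa μ hμ x
  have ho0 : ∀ x, o x ≠ 0 := fun x hx => by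
    obtain ⟨μ, hμ, hμx⟩ := exists_apply_ne_zero M hMG hM x
    have h1 := LinearMap.congr_fun hx ⟨μ, hμ⟩
    simp only [ho_apply, LinearMap.zero_apply] at h1
    exact hμx h1
  have hoG : ∀ (g : G) (x y : E), o (g • x) = o (g • y) ↔ o x = o y := fun g x y => by
    rw [ho, ho]; exact forall_apply_smul_eq_iff M hMG g x y
  have hoM : ∀ x y, o y = o x → ∀ μ ∈ M, μ y = μ x := fun x y hxy => (ho y x).1 hxy
  -- fibres
  let F : E → Finset E := fun x => Finset.univ.filter fun y => o y = o x
  have hF : ∀ x y, y ∈ F x ↔ o y = o x := fun x y => by simp [F]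
  have hΦnull : ∀ μ ∈ M, ∑ y ∈ Finset.univ.filter (fun y : E => y ∈ Φ), μ y = 0 := fun μ hμ => by
    have h1 := sum_filter_eq_zero h (hMa μ hμ) (hMb μ hμ) 1
    simpa only [one_smul] using h1
  by_cases hinj : ∀ x y : E, (∀ μ ∈ M, μ x = μ y) → x = y
  · have h1 := typeRank_le_three_of_separating h M hMa hMb hMG hM hcard hinj
    omega
  · push Not at hinj
    obtain ⟨x₁, y₁, hsame, hne⟩ := hinj
    have hx₁F : x₁ ∈ F x₁ := (hF _ _).2 rfl
    have hy₁F : y₁ ∈ F x₁ := (hF _ _).2 ((ho _ _).2 fun μ hμ => (hsame μ hμ).symm)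
    have hs2 : 2 ≤ (F x₁).card := by
      have hsub : ({x₁, y₁} : Finset E) ⊆ F x₁ := by
        intro u hu
        simp only [Finset.mem_insert, Finset.mem_singleton] at hu
        rcases hu with rfl | rfl
        · exact hx₁F
        · exact hy₁F
      have h1 := Finset.card_le_card hsub
      rwa [Finset.card_pair hne] at h1
    by_cases hC : F x₁ ∪ F (ρ • x₁) = Finset.univ
    · have h1 := finrank_le_one_of_union_fibre_eq_univ M hMa o hoM hoρ F hF hC
      omega
    · obtain ⟨z, hzC⟩ : ∃ z, z ∉ F x₁ ∪ F (ρ • x₁) := by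
        by_contra hall
        push Not at hall
        exact hC (Finset.eq_univ_of_forall hall)
      have hz : o z ≠ o x₁ ∧ o z ≠ -o x₁ := by
        rw [mem_union_fibre_iff o hoρ F hF] at hzC
        push Not at hzC
        exact hzC
      have hdisj := disjoint_union_fibre o hoρ F hF hz.1 hz.2
      have hs3 : (F x₁).card ≤ 3 := by
        have h1 := Finset.card_le_univ ((F z ∪ F (ρ • z)) ∪ (F x₁ ∪ F (ρ • x₁)))
        rw [Finset.card_union_of_disjoint hdisj, card_union_fibre h o hoρ ho0 F hF,
          card_union_fibre h o hoρ ho0 F hF, card_fibre_eq o hoG F hF x₁ z, hcard] at h1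
        omega
      rcases (show (F x₁).card = 2 ∨ (F x₁).card = 3 by omega) with hs | hs
      · have h1 := typeRank_le_four_of_card_fibre_eq_two h M hMa o ho hoρ ho0 hoG F hF hcard hΦnull hsep
          hz.1 hz.2 hs
        omega
      · have hsz : (F z).card = 3 := by rw [card_fibre_eq o hoG F hF x₁ z, hs]
        have h1 := finrank_le_one_of_card_fibre_eq_three h M hMa o hoM hoρ ho0 F hF hcard hΦnull
          hz.1 hz.2 hs hsz
        omega

end NonSeparating

/-! ### The theorems -/

section Main

variable [Fintype E] [MulAction.IsPretransitive G E]

/-- **A primitive CM type on twelve embeddings has rank at least `6`** (`B(6) ≥ 6`: the `log₂`-bound `5` of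
Ribet/Dodson is not attained).  Hypotheses: `G` transitive on `E` (the embeddings of a FIELD), `|E| = 12`, and
the translates of `Φ` separate points (primitivity, `isPrimitive_iff_forall_eq`).  Proof in the module
docstring. [cite: Dodson1987, Thm. 1.0 (ii)–(iii) and Cor. 1.5 (p. 51–53)] -/
theorem six_le_typeRank_of_card_eq_twelve (hcard : Fintype.card E = 12)
    (hsep : ∀ x y : E, (∀ g : G, g • x ∈ Φ ↔ g • y ∈ Φ) → x = y) : 6 ≤ typeRank G Φ := by
  haveI : Nonempty E := Fintype.card_pos_iff.1 (by omega)
  have h5 : 5 ≤ typeRank G Φ := by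
    have h1 := h.two_mul_card_le_two_pow_typeRank hsep
    rw [hcard] at h1
    by_contra hlt
    push Not at hlt
    have h2 : 2 ^ typeRank G Φ ≤ 2 ^ 4 := Nat.pow_le_pow_right (by norm_num) (by omega)
    omega
  by_contra hlt
  push Not at hlt
  have hrank : typeRank G Φ = 5 := by omega
  obtain ⟨W, hWa, hWb, hWdim⟩ := h.exists_balanced_anti_subspace (G := G)
  rw [hcard, hrank] at hWdim
  set S : Set (E → ℚ) := {f | (∀ x, f (ρ • x) = -f x) ∧ IsBalanced G Φ f} with hS
  set M : Submodule ℚ (E → ℚ) := Submodule.span ℚ S with hM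
  have hWM : W ≤ M := fun f hf => Submodule.subset_span ⟨hWa hf, hWb f hf⟩
  have hM2 : 2 ≤ Module.finrank ℚ M := by
    have h1 := Submodule.finrank_mono hWM
    omega
  have hMa : ∀ μ ∈ M, ∀ x, μ (ρ • x) = -μ x := by
    intro μ hμ
    induction hμ using Submodule.span_induction with
    | mem f hf => exact hf.1
    | zero => intro x; simp
    | add f g _ _ hf hg => intro x; simp only [Pi.add_apply, hf x, hg x, neg_add]
    | smul c f _ hf => intro x; simp only [Pi.smul_apply, hf x, smul_eq_mul, mul_neg]
  have hMb : ∀ μ ∈ M, IsBalanced G Φ μ := fun μ hμ => isBalanced_of_mem_span (fun f hf => hf.2) hμ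
  have hMG : ∀ μ ∈ M, ∀ g : G, (fun x => μ (g • x)) ∈ M := by
    intro μ hμ g
    induction hμ using Submodule.span_induction with
    | mem f hf =>
      refine Submodule.subset_span ⟨fun x => ?_, hf.2.comp_smul g⟩
      show f (g • ρ • x) = -f (g • x)
      rw [h.comm, hf.1]
    | zero => exact M.zero_mem
    | add f f' _ _ hf hf' => exact M.add_mem hf hf'
    | smul c f _ hf => exact M.smul_mem c hf
  exact false_of_typeRank_eq_five h M hMa hMb hMG hM2 hcard hsep hrank

/-- The same for the tree's `IsPrimitive` (Shimura Prop. 26 form). [cite: Dodson1987, Thm. 1.0 (p. 51)] -/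
theorem six_le_typeRank_of_card_eq_twelve_of_isPrimitive (hcard : Fintype.card E = 12) {φh : E}
    (hprim : IsPrimitive G Φ φh) : 6 ≤ typeRank G Φ :=
  six_le_typeRank_of_card_eq_twelve h hcard ((isPrimitive_iff_forall_eq Φ φh).1 hprim)

/-- **Rank `6` or `7`** for a primitive type on twelve embeddings (Kubota's bound above, this file's below).
[cite: Dodson1987, Thm. 1.0 (ii) (p. 51)] -/
theorem typeRank_eq_six_or_seven_of_card_eq_twelve (hcard : Fintype.card E = 12)
    (hsep : ∀ x y : E, (∀ g : G, g • x ∈ Φ ↔ g • y ∈ Φ) → x = y) :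
    typeRank G Φ = 6 ∨ typeRank G Φ = 7 := by
  haveI : Nonempty E := Fintype.card_pos_iff.1 (by omega)
  have h6 := six_le_typeRank_of_card_eq_twelve h hcard hsep
  have h7 := h.typeRank_le (G := G)
  rw [hcard] at h7
  omega

/-- **For `|E| = 12` and a primitive type: `rank(Φ) = 6` iff a balanced transversal exists** (iff the type
is degenerate).  `⇒`: the corank-one theorem `exists_transversal_isBalanced_of_typeRank_eq`; `⇐`: for a
nondegenerate type every balanced weight is `ρ`-invariant (`symm_of_isBalanced_of_typeRank_eq`), which the
indicator of a transversal is not, and `6 ≤ rank ≤ 7`.  For CM sixfolds this is the dichotomy "nondegenerate,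
all powers divisor-generated (Hazama)" against "an imaginary quadratic subfield with multiplicities `(3,3)`".
[cite: Gordon1999HodgeAVSurvey, Thm. 6.4 and 9.4] [cite: Kubota1965, §4 (p. 118–119)] -/
theorem typeRank_eq_six_iff_exists_transversal_of_card_eq_twelve (hcard : Fintype.card E = 12)
    (hsep : ∀ x y : E, (∀ g : G, g • x ∈ Φ ↔ g • y ∈ Φ) → x = y) :
    typeRank G Φ = 6 ↔ ∃ Ψ : Set E, (∀ x, x ∈ Ψ ↔ ρ • x ∉ Ψ) ∧ IsBalanced G Φ (Ψ.indicator 1) := by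
  haveI : Nonempty E := Fintype.card_pos_iff.1 (by omega)
  constructor
  · intro hr
    exact h.exists_transversal_isBalanced_of_typeRank_eq (by rw [hr, hcard])
  · rintro ⟨Ψ, hΨ, hbal⟩
    have h6 := six_le_typeRank_of_card_eq_twelve h hcard hsep
    have h7 := h.typeRank_le (G := G)
    rw [hcard] at h7
    by_contra hne
    have hr7 : typeRank G Φ = Fintype.card E / 2 + 1 := by rw [hcard]; omega
    obtain ⟨x⟩ := ‹Nonempty E›
    have hsym := h.symm_of_isBalanced_of_typeRank_eq hr7 hbal x
    by_cases hx : x ∈ Ψ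
    · have h1 : ρ • x ∉ Ψ := (hΨ x).1 hx
      rw [Set.indicator_of_notMem h1, Set.indicator_of_mem hx, Pi.one_apply] at hsym
      exact zero_ne_one hsym
    · have h1 : ρ • x ∈ Ψ := (h.rho_smul_mem_iff_of_transversal hΨ x).2 hx
      rw [Set.indicator_of_mem h1, Set.indicator_of_notMem hx, Pi.one_apply] at hsym
      exact one_ne_zero hsym

/-- **A primitive type on twelve embeddings is degenerate iff its rank is `6`, iff a balanced transversal
exists** — packaged for the number-field dress. [cite: Gordon1999HodgeAVSurvey, 9.4] -/
theorem typeRank_ne_seven_iff_exists_transversal_of_card_eq_twelve (hcard : Fintype.card E = 12)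
    (hsep : ∀ x y : E, (∀ g : G, g • x ∈ Φ ↔ g • y ∈ Φ) → x = y) :
    typeRank G Φ ≠ 7 ↔ ∃ Ψ : Set E, (∀ x, x ∈ Ψ ↔ ρ • x ∉ Ψ) ∧ IsBalanced G Φ (Ψ.indicator 1) := by
  rw [← typeRank_eq_six_iff_exists_transversal_of_card_eq_twelve h hcard hsep]
  have h67 := typeRank_eq_six_or_seven_of_card_eq_twelve h hcard hsep
  omega

end Main

end Summit.HodgeConjecture.CorCM.CMSixfoldRank

end
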